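import Literature.NumberTheory.LFunctions.TuringMethodTrudgianNumerics

/-!
# Trudgian's Theorem 2.2: evaluation of the certified computation

One compiled evaluation (`native_decide`) of
`Literature.NumberTheory.LFunctions.TrudgianNumerics.trudgianCheck` (see `TuringMethodTrudgianNumerics.lean` for the
checker, its data, and its soundness theorem `bounds_of_trudgianCheck`): `214` certified
Euler–Maclaurin evaluations of `ζ(σ)` at real `σ ∈ [1.11, 30]` (scale `2^80`, `N = 50`, `ν = 10`),
two more at `σ = 1.2498, 1.25`, four constants, and the four trapezoid sums over `ℚ`.  With it,
Trudgian's Theorem 2.2 [Trudgian 2011] — the named fact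
`Literature.NumberTheory.LFunctions.abs_integral_zetaArgS_le_trudgian` of `TuringMethod.lean` —
holds conditionally on exactly the paper's two computational lemmas: Lemma 2.5 on the whole critical
line (`Trudgian2011_lemma_2_5_allT`: Lehman's `|ζ(½+it)| ≤ 2.53 t^{1/4}`, all `t > 1`) and Booker's
Lemma 2.10 (`Trudgian2011_lemma_2_10`).  The only non-standard axiom of this file is the
`native_decide` auxiliary axiom of `TrudgianNumerics.trudgianCheck_eq_true` (trust in the Lean compiler), declared to
the gate as `computational`.

## References

* T. S. Trudgian, *Improvements to Turing's method*, Math. Comp. 80 (2011), Thm 2.2, §2.3.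
  [Trudgian2011]
-/

namespace Literature.NumberTheory.LFunctions

/-- **The certified computation passes**: `trudgianCheck = true`. [cite: Trudgian2011, §2.3] -/
theorem TrudgianNumerics.trudgianCheck_eq_true : TrudgianNumerics.trudgianCheck = true := by
  native_decide

/-- **Trudgian 2011, Theorem 2.2, conditional on its Lemmas 2.5 (all `t`) and 2.10**:
`Trudgian2011_lemma_2_5_allT → Trudgian2011_lemma_2_10 →
 ∀ t₁ t₂, 168π < t₁ → t₁ < t₂ → |∫_{t₁}^{t₂} S(t) dt| ≤ 2.067 + 0.059 log t₂`
(`Literature.NumberTheory.LFunctions.abs_integral_zetaArgS_le_trudgian`). [cite: Trudgian2011, Thm 2.2] -/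
theorem abs_integral_zetaArgS_le_trudgian_of_facts (h25 : Trudgian2011_lemma_2_5_allT)
    (hB : Trudgian2011_lemma_2_10) : abs_integral_zetaArgS_le_trudgian :=
  abs_integral_zetaArgS_le_trudgian_of_check TrudgianNumerics.trudgianCheck_eq_true h25 hB

end Literature.NumberTheory.LFunctions
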